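import Summits.CriticalPhenomena.PercolationContinuityZ3.Theorems.PercNearOneGluingNoHeavyLowerTailE3RestrictedCertCheck
import Summits.CriticalPhenomena.PercolationContinuityZ3.Theorems.PercNearOneGluingNoHeavyLowerTailE3FourPointClassesLeFive

/-!
# `NoHeavyLowerTail` (crux stmt-CriticalPhenomena-4575), E3GRP four-point classes: TRANSPORT of connectivity-event probabilities
# along an injection of vertex sets, for weights supported on the image

Support file (prover seat `prim-ineq-prove-1` gen 24; `--supports stmt-CriticalPhenomena-4575`).  No sorries, no `native_decide`,
nothing asserted about the crux.  Definitions of bookkeeping nature only: `mapP` (the pull-back of a connectivity predicate along a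
vertex map; companion of `relP` of `…E3GroupSepLeFive`, which does the same for PERMUTATIONS) and the noncomputable coordinate map
`coordMap`.

Finite certificates (`fourPointClass_le_five`, the `n ≤ 6` rung of class `γ`, any future restricted certificate of
`…E3RestrictedCertCheck`) are theorems about `Fin k` for ONE `k`; gluing theorems (`FourPointSplit.sahiE3_fourPointSplit_nonneg_of
_terminalGluing`, `…E3FourPointBetaGluing`, `TerminalGluing.*`) produce, inside a big vertex set `Fin n`, pieces whose weights are
supported on the pairs of a SMALL vertex subset.  This file bridges the two:

* `openGraph_image_reachable_iff` — for an injective vertex map `φ` and a configuration `ω` on the source, `φ a ↔ φ b` in the image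
  configuration `Sym2.map φ '' ω` iff `a ↔ b` in `ω` (walks in the image stay in the image).
* `coordMap φ hφ : Fin (mE k) → Fin (mE n)` — the coordinate of the image pair; `connB_extB_coordMap` — connectivity at the extended
  corner `extB (coordMap φ) g` between image vertices is connectivity at the corner `g`.
* `pr_mapP` — **if `w : Sym2 (Fin n) → [0,1]` vanishes on every non-diagonal pair not joining two image vertices
  (hypothesis `∀ u v, u ≠ v → w s(u,v) ≠ 0 → u, v ∈ range φ`), then
  `P_w(connEvent (mapP φ P)) = P_{w ∘ Sym2.map φ}(connEvent P)`** for every connectivity predicate `P` on `Fin k`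
  (`real_connEvent_eq_ML` on both sides, `ML_restrict` along `coordMap`, equality of the restricted tables).
* `e3Ineq_mapP_iff`, `rowHolds4_transport` — hence `E3Ineq` and the seven four-point classes `Row4Holds i` at an image quadruple
  `(φ a, φ b, φ c, φ y)` are EQUIVALENT to the same statement for the pulled-back weights on `Fin k`.
-/

namespace Summit.CriticalPhenomena.PercolationContinuityZ3.Theorems.E3GroupSepCert

open Finset MeasureTheory OneCutCert CovTransferCert
open scoped BigOperators
open Literature.Probability.Percolation Literature.Probability.LatticeModels
open Summit.CriticalPhenomena.PercolationContinuityZ3.Theorems.AdditiveGluing.Negative.Cert (Eset)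

/-! ## Open graphs of image configurations -/

section Image

variable {V W : Type*} (φ : V → W) (hφ : Function.Injective φ) (ω : Set (Sym2 V))
include hφ

/-- Adjacency in the open graph of the image configuration: exactly the images of adjacent pairs. [folklore] -/
theorem openGraph_image_adj_iff (u v : W) :
    (openGraph (Sym2.map φ '' ω)).Adj u v ↔ ∃ a b, φ a = u ∧ φ b = v ∧ (openGraph ω).Adj a b := by
  rw [openGraph_adj]
  constructor
  · rintro ⟨⟨e, he, heuv⟩, hne⟩
    induction e using Sym2.ind with
    | h a b =>
      rw [Sym2.map_mk, Sym2.eq_iff] at heuv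
      rcases heuv with ⟨rfl, rfl⟩ | ⟨rfl, rfl⟩
      · exact ⟨a, b, rfl, rfl, (openGraph_adj ω a b).2 ⟨he, fun h => hne (congrArg φ h)⟩⟩
      · exact ⟨b, a, rfl, rfl, (openGraph_adj ω b a).2 ⟨Sym2.eq_swap ▸ he, fun h => hne (congrArg φ h)⟩⟩
  · rintro ⟨a, b, rfl, rfl, hab⟩
    rw [openGraph_adj] at hab
    exact ⟨⟨s(a, b), hab.1, Sym2.map_mk φ a b⟩, fun h => hab.2 (hφ h)⟩

/-- Forward: joined vertices have joined images. [folklore] -/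
theorem openGraph_image_reachable {a b : V} (h : (openGraph ω).Reachable a b) :
    (openGraph (Sym2.map φ '' ω)).Reachable (φ a) (φ b) := by
  obtain ⟨p⟩ := h
  induction p with
  | nil => exact SimpleGraph.Reachable.refl _
  | cons hadj _ ih => exact ((openGraph_image_adj_iff φ hφ ω _ _).2 ⟨_, _, rfl, rfl, hadj⟩).reachable.trans ih

/-- Backward: a walk of the image configuration starting at an image vertex ends at an image vertex joined to it in the source.
[folklore] -/
theorem openGraph_image_walk {u v : W} (p : (openGraph (Sym2.map φ '' ω)).Walk u v) :
    ∀ a : V, φ a = u → ∃ b, φ b = v ∧ (openGraph ω).Reachable a b := by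
  induction p with
  | nil => intro a ha; exact ⟨a, ha, SimpleGraph.Reachable.refl _⟩
  | cons hadj _ ih =>
    intro a ha
    obtain ⟨a', b', ha', hb', hab⟩ := (openGraph_image_adj_iff φ hφ ω _ _).1 hadj
    obtain rfl : a' = a := hφ (ha'.trans ha.symm)
    obtain ⟨b, hb, hr⟩ := ih b' hb'
    exact ⟨b, hb, hab.reachable.trans hr⟩

/-- **Reachability between image vertices in the image configuration is reachability in the source.** [folklore] -/
theorem openGraph_image_reachable_iff (a b : V) :
    (openGraph (Sym2.map φ '' ω)).Reachable (φ a) (φ b) ↔ (openGraph ω).Reachable a b := by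
  constructor
  · rintro ⟨p⟩
    obtain ⟨b', hb', hr⟩ := openGraph_image_walk φ hφ ω p a rfl
    obtain rfl : b' = b := hφ hb'
    exact hr
  · exact openGraph_image_reachable φ hφ ω

end Image

/-! ## The coordinate map of a vertex injection -/

variable {k n : ℕ}

/-- The image of a coordinate pair under an injective vertex map is non-diagonal. [this work] -/
theorem not_isDiag_map_edgeE (φ : Fin k → Fin n) (hφ : Function.Injective φ) (t : Fin (mE k)) :
    ¬ (Sym2.map φ (edgeE k t)).IsDiag := by
  rw [Sym2.isDiag_map hφ]
  exact (mem_range_edgeE (edgeE k t)).1 ⟨t, rfl⟩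

/-- The coordinate (in `Fin (mE n)`) of the image of the coordinate pair `t` of `Fin k`. [this work] -/
noncomputable def coordMap (φ : Fin k → Fin n) (hφ : Function.Injective φ) (t : Fin (mE k)) : Fin (mE n) :=
  Classical.choose ((mem_range_edgeE _).2 (not_isDiag_map_edgeE φ hφ t))

/-- `coordMap` indexes the image pair. [this work] -/
theorem edgeE_coordMap (φ : Fin k → Fin n) (hφ : Function.Injective φ) (t : Fin (mE k)) :
    edgeE n (coordMap φ hφ t) = Sym2.map φ (edgeE k t) :=
  Classical.choose_spec ((mem_range_edgeE _).2 (not_isDiag_map_edgeE φ hφ t))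

/-- `coordMap` is injective. [this work] -/
theorem coordMap_injective (φ : Fin k → Fin n) (hφ : Function.Injective φ) : Function.Injective (coordMap φ hφ) := by
  intro t t' h
  have h' := congrArg (edgeE n) h
  rw [edgeE_coordMap, edgeE_coordMap] at h'
  exact edgeE_injective k (Sym2.map.injective hφ h')

/-- The configuration of the extended corner `extB (coordMap φ) g` is the image of the configuration of `g`. [this work] -/
theorem coe_Eset_cfg_extB_coordMap (φ : Fin k → Fin n) (hφ : Function.Injective φ) (g : Fin (mE k) → Bool) :
    (↑(Eset (cfg (extB (coordMap φ hφ) g))) : Set (Sym2 (Fin n))) = Sym2.map φ '' (↑(Eset (cfg g)) : Set (Sym2 (Fin k))) := by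
  ext e
  rw [Finset.mem_coe, mem_Eset_cfg, Set.mem_image]
  constructor
  · rintro ⟨i, hi, rfl⟩
    unfold extB at hi
    rw [decide_eq_true_iff] at hi
    obtain ⟨t, rfl, hg⟩ := hi
    exact ⟨edgeE k t, by rw [Finset.mem_coe, mem_Eset_cfg]; exact ⟨t, hg, rfl⟩, (edgeE_coordMap φ hφ t).symm⟩
  · rintro ⟨e', he', rfl⟩
    rw [Finset.mem_coe, mem_Eset_cfg] at he'
    obtain ⟨t, hg, rfl⟩ := he'
    exact ⟨coordMap φ hφ t, by rw [extB_apply (coordMap_injective φ hφ)]; exact hg, edgeE_coordMap φ hφ t⟩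

/-- **Connectivity at the extended corner between image vertices is connectivity at the corner.** [this work] -/
theorem connB_extB_coordMap (φ : Fin k → Fin n) (hφ : Function.Injective φ) (g : Fin (mE k) → Bool) (x y : Fin k) :
    connB (extB (coordMap φ hφ) g) (φ x) (φ y) = connB g x y := by
  rw [Bool.eq_iff_iff, connB_iff, connB_iff]
  show (openGraph _).Reachable (φ x) (φ y) ↔ (openGraph _).Reachable x y
  rw [coe_Eset_cfg_extB_coordMap]
  exact openGraph_image_reachable_iff φ hφ _ x y

/-! ## Pull-back of connectivity predicates -/

/-- A connectivity predicate on `Fin k` read through the vertex map `φ` (companion of `relP`). [this work] -/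
def mapP (φ : Fin k → Fin n) (P : CRel k → Bool) : CRel n → Bool := fun r => P (fun x y => r (φ x) (φ y))

/-- `mapP` commutes with conjunction. [this work] -/
theorem mapP_pAnd (φ : Fin k → Fin n) (P Q : CRel k → Bool) : mapP φ (pAnd P Q) = pAnd (mapP φ P) (mapP φ Q) := rfl

/-- `sep` under `mapP`. [this work] -/
theorem mapP_sep (φ : Fin k → Fin n) (X Y : List (Fin k)) : mapP φ (sep X Y) = sep (X.map φ) (Y.map φ) := by
  funext r; simp [mapP, sep, List.all_map, Function.comp_def]

/-- `lnk` under `mapP`. [this work] -/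
theorem mapP_lnk (φ : Fin k → Fin n) (X Y : List (Fin k)) : mapP φ (lnk X Y) = lnk (X.map φ) (Y.map φ) := by
  funext r; simp [mapP, lnk, List.any_map, Function.comp_def]

/-- The four-point rows at an image quadruple are the pulled-back rows. [this work] -/
theorem row4_mapP (i : Fin 7) (φ : Fin k → Fin n) (t : Quad k) :
    (mapP φ (row4 i t).1, mapP φ (row4 i t).2.1, mapP φ (row4 i t).2.2) = row4 i (φ t.1, φ t.2.1, φ t.2.2.1, φ t.2.2.2) := by
  obtain ⟨a, b, c, y⟩ := t
  fin_cases i <;> simp [row4, mapP_sep, mapP_lnk]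

/-- The restricted table of a pulled-back predicate is the table of the predicate. [this work] -/
theorem tabT_mapP_extB (φ : Fin k → Fin n) (hφ : Function.Injective φ) (P : CRel k → Bool) (g : Fin (mE k) → Bool) :
    tabT n (mapP φ P) (extB (coordMap φ hφ) g) = tabT k P g := by
  rw [tabT_apply, tabT_apply]
  have h : (fun x y => connB (extB (coordMap φ hφ) g) (φ x) (φ y)) = connB g :=
    funext fun x => funext fun y => connB_extB_coordMap φ hφ g x y
  simp only [mapP, h]

/-! ## Transport of probabilities for weights supported on the image -/

/-- Under the support hypothesis "every non-diagonal pair of nonzero weight joins two image vertices", the cube point of `w`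
vanishes off the range of `coordMap`. [this work] -/
theorem xOf_eq_zero_of_supportedOn {φ : Fin k → Fin n} (hφ : Function.Injective φ) {w : Sym2 (Fin n) → unitInterval}
    (hw : ∀ u v : Fin n, u ≠ v → w s(u, v) ≠ 0 → u ∈ Set.range φ ∧ v ∈ Set.range φ) (i : Fin (mE n))
    (hi : i ∉ Set.range (coordMap φ hφ)) : xOf w i = 0 := by
  unfold xOf
  by_contra hne
  apply hi
  have hne' : w (edgeE n i) ≠ 0 := fun h => hne (by rw [h]; rfl)
  have hnd : ¬ (edgeE n i).IsDiag := (mem_range_edgeE _).1 ⟨i, rfl⟩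
  have hp : edgeE n i = s((edge n i).1, (edge n i).2) := rfl
  rw [hp, Sym2.mk_isDiag_iff] at hnd
  rw [hp] at hne'
  obtain ⟨⟨a, ha⟩, ⟨b, hb⟩⟩ := hw _ _ hnd hne'
  have hab : a ≠ b := fun h => hnd (by rw [← ha, ← hb, h])
  have hnd' : ¬ (s(a, b) : Sym2 (Fin k)).IsDiag := by rw [Sym2.mk_isDiag_iff]; exact hab
  obtain ⟨t, ht⟩ := (mem_range_edgeE _).2 hnd'
  refine ⟨t, edgeE_injective n ?_⟩
  rw [edgeE_coordMap, ht, Sym2.map_mk, ha, hb, ← hp]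

/-- **Transport of the probability of a connectivity event**: for `w` supported on the image of `φ`,
`P_w(connEvent (mapP φ P)) = P_{w ∘ Sym2.map φ}(connEvent P)`. [this work] -/
theorem pr_mapP {φ : Fin k → Fin n} (hφ : Function.Injective φ) {w : Sym2 (Fin n) → unitInterval}
    (hw : ∀ u v : Fin n, u ≠ v → w s(u, v) ≠ 0 → u ∈ Set.range φ ∧ v ∈ Set.range φ)
    (P : CRel k → Bool) : pr w (mapP φ P) = pr (w ∘ Sym2.map φ) P := by
  unfold pr
  rw [real_connEvent_eq_ML, real_connEvent_eq_ML,
    ML_restrict (coordMap_injective φ hφ) _ _ (xOf_eq_zero_of_supportedOn hφ hw)]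
  have ht : (fun g => ((tabT n (mapP φ P) (extB (coordMap φ hφ) g) : ℤ) : ℝ)) = fun g => ((tabT k P g : ℤ) : ℝ) :=
    funext fun g => by rw [tabT_mapP_extB]
  have hx : xOf w ∘ coordMap φ hφ = xOf (w ∘ Sym2.map φ) := funext fun t => by
    simp only [Function.comp, xOf]
    rw [edgeE_coordMap]
  rw [ht, hx]

/-- **Transport of `E3Ineq`** along a vertex injection, for weights supported on the image. [this work] -/
theorem e3Ineq_mapP_iff {φ : Fin k → Fin n} (hφ : Function.Injective φ) {w : Sym2 (Fin n) → unitInterval}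
    (hw : ∀ u v : Fin n, u ≠ v → w s(u, v) ≠ 0 → u ∈ Set.range φ ∧ v ∈ Set.range φ) (A B C : CRel k → Bool) :
    E3Ineq w (mapP φ A) (mapP φ B) (mapP φ C) ↔ E3Ineq (w ∘ Sym2.map φ) A B C := by
  have e : ∀ P : CRel k → Bool, (prodBernoulli w).real (connEvent (mapP φ P)) =
      (prodBernoulli (w ∘ Sym2.map φ)).real (connEvent P) := fun P => pr_mapP hφ hw P
  unfold E3Ineq
  simp only [← connEvent_pAnd, ← mapP_pAnd, e]

/-- **Transport of the seven four-point classes**: for `w` supported on the image of the injection `φ`, class `i` holds for `w` at the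
image quadruple `(φ a, φ b, φ c, φ y)` iff it holds for the pulled-back weights `w ∘ Sym2.map φ` at `(a, b, c, y)`. [this work] -/
theorem rowHolds4_transport (i : Fin 7) {φ : Fin k → Fin n} (hφ : Function.Injective φ) {w : Sym2 (Fin n) → unitInterval}
    (hw : ∀ u v : Fin n, u ≠ v → w s(u, v) ≠ 0 → u ∈ Set.range φ ∧ v ∈ Set.range φ) (t : Quad k) :
    Row4Holds i w (φ t.1, φ t.2.1, φ t.2.2.1, φ t.2.2.2) ↔ Row4Holds i (w ∘ Sym2.map φ) t := by
  have hr := row4_mapP i φ t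
  have h1 := congrArg (fun x => x.1) hr
  have h2 := congrArg (fun x => x.2.1) hr
  have h3 := congrArg (fun x => x.2.2) hr
  simp only at h1 h2 h3
  unfold Row4Holds
  rw [← h1, ← h2, ← h3]
  exact e3Ineq_mapP_iff hφ hw _ _ _

end Summit.CriticalPhenomena.PercolationContinuityZ3.Theorems.E3GroupSepCert
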